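import Literature.NumberTheory.ComplexMultiplication.WeilNumberGroups
import Literature.NumberTheory.ComplexMultiplication.SerreGroupOrbitToriHomomorphism
import HarnessLib

/-!
# Milne 1999 §4: `W(p^∞) = lim→ W(pⁿ)`, the germs `[π]` («`π^{n′}` and `π′^{n}` differ by a root of unity»), the Weil-number
# pro-torus `P` with `X^*(P) = W(p^∞)` and its character `p`, `W_{1,+}(p^∞)`, the tori `(L^Π, l^Π)` of the `Γ`-orbits `Π`, and
# the map `β^Π : (P, p) → (L^Π, l^Π)` (J. S. Milne, *Lefschetz motives and the Tate conjecture*, Compositio Math. 117 (1999),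
# §4 pp. 60 and 62)

Family `hodge`, lane `lit-hodgefound` (Layer A3; seat `lit-hodgefound-p27`, generation 15, row g15-#3); topic
`Literature/NumberTheory/ComplexMultiplication`, namespace `Literature.NumberTheory.ComplexMultiplication.CMNumbers`.  SECOND FILE
of Milne 1999 §4 (DAG-B node B5-09's objects: «no Honda–Tate record in `Literature/` … the Weil-number torus `P` absent»), sequel
of g15-#2 `WeilNumberGroups.lean` (`IsWeilNumber`, `W(pⁿ) = weilGroup p n ≤ (ℚ^{cm})ˣ`, `weilExp`, `weilAct`, the directed system
`weilTransition` along divisibility, `weilOnePlus = W_{1,+}(pⁿ)`), of g15-#1 `SerreGroupOrbitToriHomomorphism.lean` §0 (the generic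
`OrbitTorus.liftChar`: `f ↦ Σ f(s)v(s)` factors through `R[S]/{f = ιf, Σ f = 0}` when `v(s) + v(ιs)` is constant and the target is
torsion-free), of Q768 FILE 1 `CharacterModuleTorusPoints.lean` (`torusPoints` — the group of multiplicative type with a given
`Γ`-character module through its functor of points; `eval`, `comap`) and of Q731 `CMTypeOrbitTorus.lean` §1
(`OrbitTorus.CharModule R S ι = R[S]/{f = ιf, Σ f = 0}`, `rep`, `tChar`).  The direct limit is Mathlib's `DirectLimit` of a
directed system (`Mathlib.Order.DirectedInverseSystem`, `Mathlib.Algebra.Colimit.DirectLimit`) over the positive integers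
ordered by DIVISIBILITY (`LevelIndex`), behind the type synonym `WeilLimit p`.  Small carriers with bodies + THEOREMS; no named
fact (D-0026, net debt 0).

THE PRINT.  [Milne1999] §4 p. 60 L1–L12 and L22–L27 (held `paper:doi-10-1023-a-1000776613765` p0016), verbatim: «If `n | n′`,
then `π ↦ π^{n′/n}` maps `W(pⁿ)` into `W(p^{n′})`, and we define `W(p^∞) = lim→_n W(pⁿ)`. Thus an element of `W(p^∞)` is
represented by an element of `W(pⁿ)` for some `n`, and elements `π ∈ W(pⁿ)` and `π′ ∈ W(p^{n′})` represent the same element of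
`W(p^∞)` if and only if `π^{n′}` and `π′^{n}` differ by a root of unity. We let `[π]` denote the element of `W(p^∞)` represented
by `π`.  There is a natural action of `Γ` on `W(p^∞)`, and the Weil-number torus `P` is defined to be the pro-torus over `ℚ` with
`X^*(P) = W(p^∞)`.  Let `W_{1,+}(pⁿ)` be the subset of `W(pⁿ)` consisting of those `π` that are of weight `−1` and are algebraic
integers, and let `W_{1,+}(p^∞) = lim→ W_{1,+}(pⁿ)`. … THE FUNDAMENTAL GROUP OF LMot(𝔽).  For a `Γ`-orbit `Π` in `W_{1,+}(p^∞)`,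
define `L^Π` to be the torus over `ℚ` with character group `X^*(L^Π) = {f : Π → ℤ}/{f | f = ιf and Σ_{π∈Π} f(π) = 0}`.  The
element `π + ιπ` of `X^*(L^Π)` is independent of the choice of `π ∈ Π` and is fixed by `Γ`. It therefore defines a homomorphism
`l^Π : L^Π → 𝔾_m` rational over `ℚ`.»; p. 62 L14–L20 (p0018), «THE MAP `β^K : P^K → L^K`.  The element `p ∈ K` is a Weil
`p`-number of weight `−2`. Its class `[p]` in `W^K(p^∞)` is fixed under the action of `Γ`, and so defines homomorphism
`p^K : P^K → 𝔾_m` rational over `ℚ`.  Let `Π` be a `Γ`-orbit in `W^K_{1,+}(p^∞)`. The map `f ↦ ∏_{π∈Π} π^{f(π)} : ℤ^Π → W^K(p^∞)`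
factors through `X^*(L^Π)` and, hence, defines a homomorphism `β^Π : P^K → L^Π`. This map sends `p^K` to `l^Π` …».

DICTIONARY.  As in FILE g15-#2: Weil numbers live in `ℚ^{cm}` (proved there), `Γ_{cm} = Gal(ℚ^{cm}/ℚ) = (cmNumbers ≃ₐ[ℚ]
cmNumbers)` (through which Milne's `Γ = Gal(ℚ^{al}/ℚ)` acts), `ι = cmNumbersConj`.  The index set of the system is `ℕ≥1` ordered
by divisibility (`LevelIndex`; directed: `n, n′ ≤ nn′`); `W(p^∞) = WeilLimit p = DirectLimit (n ↦ W(pⁿ)) weilTransition`;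
`[π] = weilGerm n π`; `X^*(P) = Additive (WeilLimit p)` with `Γ`-module structure `weilLimRep`, and `P(R) = torusPoints ℚ ℚ^{cm} R
weilLimRep` for every commutative `ℚ`-algebra `R` (the pro-torus through its points over the common splitting field `ℚ^{cm}`,
exactly as the Serre group `S = lim← S^K` in g13-#3); `X^*(L^Π) = OrbitTorus.CharModule ℤ Π ι` for `Π = Γ·ϖ ⊂ W(p^∞)`,
`l^Π = OrbitTorus.tChar`, `L^Π(R) = torusPoints … (OrbitTorus.rep)`.  §7 is p. 62's `β` at the level `ℚ^{cm}` (for `W(p^∞)`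
itself; Milne states it for the quotients `W^K(p^∞)`, `K ⊂ ℚ^{cm}` finite — NOT here): for an orbit `Π` of weight `−1`,
`π·ιπ = [p]` for every `π ∈ Π`, so `f ↦ ∏ π^{f(π)}` kills `{f = ιf, Σ f = 0}` because `W(p^∞)` is torsion-free
(`(∏ π^{f(π)})² = [p]^{Σ f} = 1`) — the mechanism of g15-#1 §0.  Milne's weight is `−weilLimExp`.

WHAT IS HERE (all PROVED):
* §1 `LevelIndex` (= `ℕ≥1`, `⟨n⟩ ≤ ⟨n′⟩ ↔ n ∣ n′`), a directed preorder (`IsDirectedOrder`, `Inhabited`).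
* §2 `weilLevel`/`weilSys` + **`weilSys_directedSystem`** (Mathlib `DirectedSystem` from g15-#2's `weilTransition_refl/_trans`); DEF
  **`WeilLimit p = W(p^∞) = lim→ W(pⁿ)`** (a `CommGroup`); DEF **`weilGerm n π = [π]`**, **`exists_weilGerm_eq`** («an element of
  `W(p^∞)` is represented by an element of `W(pⁿ)` for some `n`»), `weilGerm_induction`, `weilGerm_mul/_one/_inv/_pow`, DEF
  `weilGermHom n : W(pⁿ) →* W(p^∞)`, **`weilGerm_weilTransition`** (`[π^{n′/n}] = [π]`), **`weilGerm_eq_weilGerm_iff`** — THE PRINTED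
  CRITERION: `[π] = [π′]` iff `(π^{n′}/π′^{n})^k = 1` for some `k ≥ 1` («differ by a root of unity»), **`weilGerm_eq_one_iff`** (the
  kernel of `W(pⁿ) → W(p^∞)` is the roots of unity), **`WeilLimit.eq_one_of_pow_eq_one`** (`W(p^∞)` is TORSION-FREE — as `X^*` of a
  pro-torus must be; §7 `WeilLimit.instIsMulTorsionFree`).
* §3 DEF **`weilLimExp : W(p^∞) → ℤ`** (`DirectLimit.lift` of the weights; `weilLimExp_weilGerm`), DEF `weilLimExpHom : W(p^∞) →*
  Multiplicative ℤ`; «There is a natural action of `Γ` on `W(p^∞)`»: DEF **`weilLimAct σ : W(p^∞) →* W(p^∞)`** (`DirectLimit.map` of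
  g15-#2's `weilAct`; `weilLimAct_weilGerm : σ[π] = [σπ]`, `_one`, `_mul`), INSTANCE **`MulAction Γ (W(p^∞))`** (`smul_weilGerm`,
  `smul_mul_weilLimit`), **`weilLimExp_smul`** (weights `Γ`-invariant), DEF **`weilLimRep p : Representation ℤ Γ (Additive W(p^∞))`** =
  `X^*(P)` AS A `Γ`-MODULE; DEF `natCastPowUnit n = pⁿ ∈ W(pⁿ)`, DEF **`pGerm = [p]`**, **`smul_pGerm`** («its class `[p]` … is fixed
  under the action of `Γ`»), `weilLimExp_pGerm = 2` (weight `−2`), `pGerm_ne_one`.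
* §4 DEF **`weilLimOnePlus p = W_{1,+}(p^∞)`** (germs of `W_{1,+}(pⁿ)`), `weilGerm_mem_weilLimOnePlus`, `weilLimExp_eq_one_of_mem` (weight
  `−1`), **`smul_mem_weilLimOnePlus`** / `orbit_subset_weilLimOnePlus` (`Γ`-stable: a union of `Γ`-orbits `Π`), `weilLimOnePlus_nonempty`
  (`[p] ∈ W_{1,+}(p²) → W_{1,+}(p^∞)`).
* §5 DEF **`weilTorusPoints p R = P(R) = Hom_Γ(W(p^∞), (ℚ^{cm} ⊗ R)ˣ)`** («the pro-torus over `ℚ` with `X^*(P) = W(p^∞)`»), DEF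
  **`germChar x : P(R) →* (ℚ^{cm} ⊗ R)ˣ`** (each `[π]` is a character of `P_{ℚ^{cm}}`), `germChar_mul`, **`galUnits_germChar_pGerm`** (the
  character `p : P → 𝔾_m` is RATIONAL OVER `ℚ`: its values are `Γ`-invariant).
* §6 DEF **`weilOrbitChar R ϖ = X^*(L^Π)`**, `Π = Γ·ϖ` («`{f : Π → ℤ}/{f | f = ιf and Σ f(π) = 0}`»), DEF `weilOrbitRep` (its
  `Γ`-module structure), DEF **`lWeil R ϖ = l^Π`** (the class of `π + ιπ`), **`lWeil_eq_tChar`** («independent of the choice of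
  `π ∈ Π`»), **`weilOrbitRep_lWeil`** («fixed by `Γ`»), `lWeil_ne_zero`, `cmNumbersConj_smul_mem_orbit`; DEF **`weilOrbitTorusPoints R ϖ
  = L^Π(R)`**, DEF **`lWeilPoints R ϖ : L^Π(R) →* (ℚ^{cm} ⊗ R)ˣ`**, **`galUnits_lWeilPoints`** («defines a homomorphism `l^Π : L^Π → 𝔾_m`
  rational over `ℚ`»).
* §7 «THE MAP `β`» (p. 62): INSTANCE `WeilLimit.instIsMulTorsionFree`; `weilGerm_natCastPowUnit` (`[pⁿ]_n = [p]`),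
  **`weilGerm_mul_weilGerm_conj` / `mul_conj_smul_eq_pGerm`** (`x·ιx = [p]` for `x` of weight `−1`), `weilLimExp_coe_orbit`; DEF
  **`betaChar ϖ hϖ : X^*(L^Π) →ₗ[ℤ] X^*(P)`** for an orbit of weight `−1` («`f ↦ ∏ π^{f(π)}` … factors through `X^*(L^Π)`»;
  `betaChar_mk_single : [δ_π] ↦ [π]`, **`toMul_betaChar_mk`** — the printed product formula), **`betaChar_weilOrbitRep`**
  (`Γ`-equivariant), **`betaChar_lWeil : l^Π ↦ [p]`** («This map sends `p` to `l^Π`»); DEF **`betaPoints R ϖ hϖ : P(R) →* L^Π(R)`** (FILE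
  1's `torusPoints.comap`), `betaPoints_apply_mk_single` (`β^Π(f)([δ_π]) = f([π])`), `map_betaPoints` (natural in `R`),
  **`lWeilPoints_betaPoints` / `lWeilPoints_comp_betaPoints : l^Π ∘ β^Π = p`** — `β^Π : (P, p) → (L^Π, l^Π)` is a morphism of pairs.

NOT here: `W^K(pⁿ)`, the invariants `f_π(w) = ord_w(π)[K_w:ℚ_p]/ord_w(pⁿ)` and `P^K` (§4 p. 61), the injectivity of
`β^K = (β^Π)_Π` («corresponds to a surjective map on the character groups») and `β : (P, p) → (L, l)` (p. 62 L20–L23), Lemma 4.2,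
the map `α : P → S` and Lemma 5.1 (§5) — later rows; Prop. 4.1 (Honda–Tate), Thm. 4.3 (`LMot(𝔽)` and its fundamental group),
Thm. 5.4, Thm. 6.1 (`P = L ∩ S`) — Layer B (B5-09).

## References

* [Milne1999] J. S. Milne, *Lefschetz motives and the Tate conjecture*, Compositio Math. 117 (1999) 45–76 — §4 «Weil numbers and
  abelian varieties» p. 60 L1–L12, «The fundamental group of LMot(𝔽)» p. 60 L22–L27, «The map β» p. 62 L14–L20 (held
  `paper:doi-10-1023-a-1000776613765` p0016, p0018).
* [Milne2017] J. S. Milne, *Algebraic Groups*, CUP (2017), Ch. 12 Thm. 12.9 / 12.23 (groups of multiplicative type ↔ `Γ`-modules;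
  through the tree's `RingTheory/GaloisAlgebras/CharacterModuleTorusPoints.lean`).
* [MilneCM2006] J. S. Milne, *Complex Multiplication* (course notes), Ch. I §1 Rem. 1.6 (`ℚ^{cm}`; the tree's `NumberFields/CMNumbers.lean`).

Provenance: lane `lit-hodgefound`, seat `lit-hodgefound-p27` gen 15 (agent `literature-prover-lit-hodgefound-p27-g15-0`),
row g15-#3 (INBOX 2026-08-23T00:44:17Z l.5609).
-/

set_option autoImplicit false

noncomputable section

open scoped TensorProduct

namespace Literature.NumberTheory.ComplexMultiplication

namespace CMNumbers

open Literature.NumberTheory.NumberFields (cmNumbers cmNumbersConj cmNumbersConj_mul_self cmNumbersConj_mul_comm)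
open Literature.RingTheory.GaloisAlgebras.CharacterModuleTorus (torusPoints galUnits)

/-! ### §1 The index set: positive integers ordered by divisibility -/

/-- **The levels `n ≥ 1` of the system `(W(pⁿ))_n`, ordered by DIVISIBILITY** («If `n | n′`, then `π ↦ π^{n′/n}` maps `W(pⁿ)`
into `W(p^{n′})`»). [cite: Milne1999, §4 p. 59 L31 – p. 60 L1] -/
structure LevelIndex : Type where
  /-- the level `n ≥ 1` -/
  n : ℕ+

namespace LevelIndex

/-- `n ≤ n′` iff `n ∣ n′`. [cite: Milne1999, §4 p. 60 L1] -/
instance : Preorder LevelIndex where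
  le a b := (a.n : ℕ) ∣ (b.n : ℕ)
  le_refl _ := dvd_refl _
  le_trans _ _ _ h h' := dvd_trans h h'

/-- Unfolding the order. [cite: Milne1999, §4 p. 60 L1] -/
theorem le_iff (a b : LevelIndex) : a ≤ b ↔ (a.n : ℕ) ∣ (b.n : ℕ) := Iff.rfl

/-- The order is DIRECTED: `n, n′ ∣ nn′`. [cite: Milne1999, §4 p. 60 L1 («lim→_n W(pⁿ)»)] -/
instance : IsDirectedOrder LevelIndex :=
  ⟨fun a b => ⟨⟨a.n * b.n⟩, Dvd.intro _ rfl, Dvd.intro_left _ rfl⟩⟩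

/-- The level `1`. [cite: Milne1999, §4 p. 60 L1] -/
instance : Inhabited LevelIndex := ⟨⟨1⟩⟩

/-- The level `n` as an index is `⟨n⟩`; `⟨n⟩ ≤ ⟨n′⟩ ↔ n ∣ n′`. [cite: Milne1999, §4 p. 60 L1] -/
theorem mk_le_mk_iff (n n' : ℕ+) : (⟨n⟩ : LevelIndex) ≤ ⟨n'⟩ ↔ (n : ℕ) ∣ (n' : ℕ) := Iff.rfl

end LevelIndex

/-! ### §2 `W(p^∞) = lim→ W(pⁿ)` and the germs `[π]` -/

section Limit

variable (p : ℕ) [hp : Fact p.Prime]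

/-- The system `n ↦ W(pⁿ)`. [cite: Milne1999, §4 p. 60 L1] -/
abbrev weilLevel (i : LevelIndex) : Type := weilGroup p i.n

/-- The transition homomorphisms of the system (`weilTransition` of FILE g15-#2). [cite: Milne1999, §4 p. 59 L31 – p. 60 L1] -/
def weilSys (i j : LevelIndex) (h : i ≤ j) : weilLevel p i →* weilLevel p j :=
  weilTransition h

/-- Values of the transition maps: `u ↦ u^{n′/n}`. [cite: Milne1999, §4 p. 59 L31 – p. 60 L1] -/
@[simp] theorem coe_weilSys (i j : LevelIndex) (h : i ≤ j) (u : weilLevel p i) :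
    ((weilSys p i j h u : weilGroup p j.n) : cmNumbersˣ) = (u : cmNumbersˣ) ^ ((j.n : ℕ) / (i.n : ℕ)) := rfl

/-- **`(W(pⁿ))_{n ≥ 1}` is a DIRECTED SYSTEM along divisibility** (`weilTransition_refl`, `weilTransition_trans`).
[cite: Milne1999, §4 p. 60 L1 («W(p^∞) = lim→_n W(pⁿ)»)] -/
instance weilSys_directedSystem : DirectedSystem (weilLevel p) fun _ _ h => weilSys p _ _ h where
  map_self _ x := weilTransition_refl x
  map_map _ _ _ hij hjk x := weilTransition_trans hij hjk x

/-- **`W(p^∞) = lim→_n W(pⁿ)`** — the direct limit of the groups of Weil `pⁿ`-numbers along `π ↦ π^{n′/n}` (Mathlib's `DirectLimit`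
of the directed system, behind a type synonym so that only the structures defined here act on it; a commutative group).
[cite: Milne1999, §4 p. 60 L1–L2] -/
def WeilLimit : Type := DirectLimit (weilLevel p) (weilSys p)

/-- `W(p^∞)` is a commutative group (the direct limit of commutative groups). [cite: Milne1999, §4 p. 60 L1–L2] -/
instance WeilLimit.instCommGroup : CommGroup (WeilLimit p) :=
  inferInstanceAs (CommGroup (DirectLimit (weilLevel p) (weilSys p)))

variable {p}

/-- **`[π] ∈ W(p^∞)`, the element represented by `π ∈ W(pⁿ)`** («We let `[π]` denote the element of `W(p^∞)` represented by `π`»).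
[cite: Milne1999, §4 p. 60 L6–L7] -/
def weilGerm (n : ℕ+) (u : weilGroup p n) : WeilLimit p :=
  (⟦⟨⟨n⟩, u⟩⟧ : DirectLimit (weilLevel p) (weilSys p))

/-- **«an element of `W(p^∞)` is represented by an element of `W(pⁿ)` for some `n`»**. [cite: Milne1999, §4 p. 60 L2–L4] -/
theorem exists_weilGerm_eq (x : WeilLimit p) : ∃ (n : ℕ+) (u : weilGroup p n), weilGerm n u = x := by
  obtain ⟨i, u, h⟩ := DirectLimit.exists_eq_mk (weilSys p) x
  exact ⟨i.n, u, h.symm⟩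

/-- Induction on germs. [cite: Milne1999, §4 p. 60 L2–L4] -/
@[elab_as_elim] theorem weilGerm_induction {C : WeilLimit p → Prop} (h : ∀ (n : ℕ+) (u : weilGroup p n), C (weilGerm n u))
    (x : WeilLimit p) : C x := by
  obtain ⟨n, u, rfl⟩ := exists_weilGerm_eq x
  exact h n u

/-- `[π][π′] = [ππ′]` at a common level. [cite: Milne1999, §4 p. 60 L1–L7] -/
theorem weilGerm_mul (n : ℕ+) (u v : weilGroup p n) : weilGerm n u * weilGerm n v = weilGerm n (u * v) := by
  have h := DirectLimit.mul_def (f := weilSys p) (⟨n⟩ : LevelIndex) u v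
  exact h

/-- `[1] = 1`. [cite: Milne1999, §4 p. 60 L1–L7] -/
theorem weilGerm_one (n : ℕ+) : weilGerm n (1 : weilGroup p n) = 1 := by
  have h := DirectLimit.one_def (f := weilSys p) (⟨n⟩ : LevelIndex)
  exact h.symm

/-- `[π⁻¹] = [π]⁻¹`. [cite: Milne1999, §4 p. 60 L1–L7] -/
theorem weilGerm_inv (n : ℕ+) (u : weilGroup p n) : weilGerm n u⁻¹ = (weilGerm n u)⁻¹ := by
  have h := DirectLimit.inv_def (f := weilSys p) (⟨n⟩ : LevelIndex) u
  exact h.symm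

/-- `[π^k] = [π]^k`. [cite: Milne1999, §4 p. 60 L1–L7] -/
theorem weilGerm_pow (n : ℕ+) (u : weilGroup p n) (k : ℕ) : weilGerm n (u ^ k) = weilGerm n u ^ k := by
  induction k with
  | zero => rw [pow_zero, pow_zero, weilGerm_one]
  | succ k ih => rw [pow_succ, pow_succ, ← weilGerm_mul, ih]

variable (n : ℕ+) in
/-- `π ↦ [π]` is a group homomorphism `W(pⁿ) → W(p^∞)`. [cite: Milne1999, §4 p. 60 L1–L7] -/
def weilGermHom : weilGroup p n →* WeilLimit p where
  toFun := weilGerm n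
  map_one' := weilGerm_one n
  map_mul' u v := (weilGerm_mul n u v).symm

/-- `weilGermHom n π = [π]`. [cite: Milne1999, §4 p. 60 L6–L7] -/
@[simp] theorem weilGermHom_apply (n : ℕ+) (u : weilGroup p n) : weilGermHom n u = weilGerm n u := rfl

/-- **`[π^{n′/n}] = [π]`**: a Weil number and its image under a transition map represent the same germ.
[cite: Milne1999, §4 p. 60 L1–L7] -/
theorem weilGerm_weilTransition {n n' : ℕ+} (h : (n : ℕ) ∣ (n' : ℕ)) (u : weilGroup p n) :
    weilGerm n' (weilTransition h u) = weilGerm n u := by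
  have e := DirectLimit.mk_apply (f := weilSys p) (⟨n⟩ : LevelIndex) (⟨n'⟩ : LevelIndex) u h
  exact e

/-- **THE PRINTED CRITERION: `[π] = [π′]` for `π ∈ W(pⁿ)`, `π′ ∈ W(p^{n′})` iff `π^{n′}` and `π′^{n}` differ by a root of unity**
(`(π^{n′}·π′^{−n})^k = 1` for some `k ≥ 1`).  Proof: in the direct limit `[π] = [π′]` iff `π^{N/n} = π′^{N/n′}` at some common
level `N`; with `N = n a = n′ b` this gives `(π^{n′}/π′^{n})^{ab} = 1`, and conversely `N = n n′ k` works.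
[cite: Milne1999, §4 p. 60 L2–L6] -/
theorem weilGerm_eq_weilGerm_iff {n n' : ℕ+} (u : weilGroup p n) (u' : weilGroup p n') :
    weilGerm n u = weilGerm n' u' ↔
      ∃ k : ℕ, k ≠ 0 ∧ ((u : cmNumbersˣ) ^ (n' : ℕ) / (u' : cmNumbersˣ) ^ (n : ℕ)) ^ k = 1 := by
  constructor
  · intro h
    obtain ⟨i, hx, hy, heq⟩ := Quotient.exact h
    -- `i.n = n a = n' b`, `u^{a} = u'^{b}` in `W(p^{i})`
    obtain ⟨a, ha⟩ := (LevelIndex.le_iff _ _).mp hx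
    obtain ⟨b, hb⟩ := (LevelIndex.le_iff _ _).mp hy
    change (i.n : ℕ) = n * a at ha
    change (i.n : ℕ) = n' * b at hb
    have e1 : (i.n : ℕ) / (n : ℕ) = a := by rw [ha, Nat.mul_div_cancel_left a n.pos]
    have e2 : (i.n : ℕ) / (n' : ℕ) = b := by rw [hb, Nat.mul_div_cancel_left b n'.pos]
    have heq' : (u : cmNumbersˣ) ^ a = (u' : cmNumbersˣ) ^ b := by
      have h1 := congrArg (fun w : weilGroup p i.n => (w : cmNumbersˣ)) heq
      simp only [coe_weilSys] at h1
      rwa [e1, e2] at h1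
    have ha0 : a ≠ 0 := fun h0 => by rw [h0, mul_zero] at ha; exact PNat.ne_zero _ ha
    have hb0 : b ≠ 0 := fun h0 => by rw [h0, mul_zero] at hb; exact PNat.ne_zero _ hb
    refine ⟨a * b, mul_ne_zero ha0 hb0, ?_⟩
    rw [div_pow, ← pow_mul, ← pow_mul, div_eq_one]
    -- `u^{n' a b} = (u^a)^{n' b}` and `u'^{n a b} = (u'^b)^{n' b}` with `n a = n' b`
    calc (u : cmNumbersˣ) ^ ((n' : ℕ) * (a * b)) = ((u : cmNumbersˣ) ^ a) ^ ((n' : ℕ) * b) := by rw [← pow_mul]; ring_nf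
      _ = ((u' : cmNumbersˣ) ^ b) ^ ((n' : ℕ) * b) := by rw [heq']
      _ = (u' : cmNumbersˣ) ^ ((n : ℕ) * (a * b)) := by
        rw [← pow_mul]
        congr 1
        calc b * ((n' : ℕ) * b) = ((n' : ℕ) * b) * b := by ring
          _ = ((n : ℕ) * a) * b := by rw [← hb, ha]
          _ = (n : ℕ) * (a * b) := by ring
  · rintro ⟨k, hk, h⟩
    rw [div_pow, div_eq_one, ← pow_mul, ← pow_mul] at h
    -- both germs equal the germ of `u^{n' k} = u'^{n k}` at the common level `n n' k`
    have hk' : 0 < k := Nat.pos_of_ne_zero hk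
    have hN1 : (n : ℕ) ∣ ((n * (n' * ⟨k, hk'⟩) : ℕ+) : ℕ) := Dvd.intro _ rfl
    have hN2 : (n' : ℕ) ∣ ((n * (n' * ⟨k, hk'⟩) : ℕ+) : ℕ) :=
      ⟨n * k, by rw [PNat.mul_coe, PNat.mul_coe, PNat.mk_coe]; ring⟩
    rw [← weilGerm_weilTransition hN1 u, ← weilGerm_weilTransition hN2 u']
    congr 1
    refine Subtype.ext ?_
    rw [coe_weilTransition, coe_weilTransition]
    have e1 : ((n * (n' * ⟨k, hk'⟩) : ℕ+) : ℕ) / (n : ℕ) = n' * k := by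
      rw [PNat.mul_coe, PNat.mul_coe, PNat.mk_coe, Nat.mul_div_cancel_left _ n.pos]
    have e2 : ((n * (n' * ⟨k, hk'⟩) : ℕ+) : ℕ) / (n' : ℕ) = n * k := by
      rw [PNat.mul_coe, PNat.mul_coe, PNat.mk_coe, Nat.mul_left_comm, Nat.mul_div_cancel_left _ n'.pos]
    rw [e1, e2]
    exact h

/-- **The kernel of `W(pⁿ) → W(p^∞)` consists of the roots of unity**: `[π] = 1` iff `π^k = 1` for some `k ≥ 1`.
[cite: Milne1999, §4 p. 60 L2–L6] -/
theorem weilGerm_eq_one_iff {n : ℕ+} (u : weilGroup p n) :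
    weilGerm n u = 1 ↔ ∃ k : ℕ, k ≠ 0 ∧ (u : cmNumbersˣ) ^ k = 1 := by
  rw [← weilGerm_one n, weilGerm_eq_weilGerm_iff]
  simp only [Subgroup.coe_one, one_pow, div_one]
  constructor
  · rintro ⟨k, hk, h⟩
    exact ⟨(n : ℕ) * k, mul_ne_zero n.ne_zero hk, by rw [pow_mul, h]⟩
  · rintro ⟨k, hk, h⟩
    exact ⟨k, hk, by rw [← pow_mul, mul_comm, pow_mul, h, one_pow]⟩

/-- **`W(p^∞)` IS TORSION-FREE** (`x^k = 1`, `k ≥ 1` ⟹ `x = 1`: a root of unity represents the trivial germ) — as the character group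
of the PRO-TORUS `P` must be («the Weil-number torus `P` … the pro-torus over `ℚ` with `X^*(P) = W(p^∞)`»).
[cite: Milne1999, §4 p. 60 L8–L10] -/
theorem WeilLimit.eq_one_of_pow_eq_one {x : WeilLimit p} {k : ℕ} (hk : k ≠ 0) (h : x ^ k = 1) : x = 1 := by
  induction x using weilGerm_induction with
  | h n u =>
    rw [← weilGerm_pow, weilGerm_eq_one_iff] at h
    obtain ⟨k', hk', h'⟩ := h
    rw [weilGerm_eq_one_iff]
    exact ⟨k * k', mul_ne_zero hk hk', by rw [pow_mul, ← Subgroup.coe_pow, h']⟩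

/-! ### §3 The weight on `W(p^∞)` and the `Γ`-action («There is a natural action of `Γ` on `W(p^∞)`») -/

/-- **The weight exponent on `W(p^∞)`**: `[π] ↦ weilExp π` (well defined: the transition maps preserve weights,
`weilExp_weilTransition`). [cite: Milne1999, §4 p. 59 L25 – p. 60 L7] -/
def weilLimExp : WeilLimit p → ℤ :=
  DirectLimit.lift (weilSys p) (fun i (u : weilLevel p i) => weilExp u) fun _ _ h u => (weilExp_weilTransition h u).symm

/-- `weilLimExp [π] = weilExp π`. [cite: Milne1999, §4 p. 59 L25 – p. 60 L7] -/
@[simp] theorem weilLimExp_weilGerm (n : ℕ+) (u : weilGroup p n) : weilLimExp (weilGerm n u) = weilExp u := rfl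

/-- Two germs at a common level: `[π]_n = [π^{n′}]_{nn′}`, `[π′]_{n′} = [π′^{n}]_{nn′}`. [cite: Milne1999, §4 p. 60 L1–L7] -/
theorem weilGerm_eq_weilGerm_mul_left (n n' : ℕ+) (u : weilGroup p n) :
    weilGerm n u = weilGerm (n * n') (weilTransition (Dvd.intro (n' : ℕ) rfl : (n : ℕ) ∣ ((n * n' : ℕ+) : ℕ)) u) :=
  (weilGerm_weilTransition _ u).symm

/-- [cite: Milne1999, §4 p. 60 L1–L7] -/
theorem weilGerm_eq_weilGerm_mul_right (n n' : ℕ+) (u' : weilGroup p n') :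
    weilGerm n' u' = weilGerm (n * n') (weilTransition (Dvd.intro_left (n : ℕ) rfl : (n' : ℕ) ∣ ((n * n' : ℕ+) : ℕ)) u') :=
  (weilGerm_weilTransition _ u').symm

/-- **The weight homomorphism `W(p^∞) → ℤ`.** [cite: Milne1999, §4 p. 59 L25 – p. 60 L7] -/
def weilLimExpHom : WeilLimit p →* Multiplicative ℤ where
  toFun x := Multiplicative.ofAdd (weilLimExp x)
  map_one' := by rw [← weilGerm_one 1, weilLimExp_weilGerm, weilExp_one]; rfl
  map_mul' x y := by
    induction x using weilGerm_induction with
    | h n u =>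
      induction y using weilGerm_induction with
      | h n' u' =>
        rw [weilGerm_eq_weilGerm_mul_left n n' u, weilGerm_eq_weilGerm_mul_right n n' u', weilGerm_mul,
          weilLimExp_weilGerm, weilLimExp_weilGerm, weilLimExp_weilGerm, weilExp_mul, ofAdd_add]

/-- `weilLimExpHom x = weilLimExp x` (multiplicative notation). [cite: Milne1999, §4 p. 59 L25 – p. 60 L7] -/
@[simp] theorem weilLimExpHom_apply (x : WeilLimit p) : weilLimExpHom x = Multiplicative.ofAdd (weilLimExp x) := rfl

/-- The action of `σ ∈ Γ` on `W(p^∞)` as a FUNCTION (Mathlib's `DirectLimit.map` of the compatible level actions `weilAct`,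
`weilTransition_weilAct`). [cite: Milne1999, §4 p. 60 L8–L9] -/
def weilLimActFun (σ : cmNumbers ≃ₐ[ℚ] cmNumbers) : WeilLimit p → WeilLimit p :=
  DirectLimit.map (weilSys p) (weilSys p) (fun i (u : weilLevel p i) => weilAct p i.n σ u)
    fun _ _ h u => weilTransition_weilAct h σ u

/-- `σ[π] = [σπ]` for the function. [cite: Milne1999, §4 p. 60 L8–L9] -/
@[simp] theorem weilLimActFun_weilGerm (σ : cmNumbers ≃ₐ[ℚ] cmNumbers) (n : ℕ+) (u : weilGroup p n) :
    weilLimActFun σ (weilGerm n u) = weilGerm n (weilAct p n σ u) := rfl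

/-- **The action of `σ ∈ Γ` on `W(p^∞)`**, `σ[π] = [σπ]`, as a group homomorphism. [cite: Milne1999, §4 p. 60 L8–L9] -/
def weilLimAct (σ : cmNumbers ≃ₐ[ℚ] cmNumbers) : WeilLimit p →* WeilLimit p where
  toFun := weilLimActFun σ
  map_one' := by rw [← weilGerm_one 1, weilLimActFun_weilGerm, map_one]
  map_mul' x y := by
    induction x using weilGerm_induction with
    | h n u =>
      induction y using weilGerm_induction with
      | h n' u' =>
        rw [weilGerm_eq_weilGerm_mul_left n n' u, weilGerm_eq_weilGerm_mul_right n n' u', weilGerm_mul,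
          weilLimActFun_weilGerm, weilLimActFun_weilGerm, weilLimActFun_weilGerm, map_mul, weilGerm_mul]

/-- **`σ[π] = [σπ]`.** [cite: Milne1999, §4 p. 60 L8–L9] -/
@[simp] theorem weilLimAct_weilGerm (σ : cmNumbers ≃ₐ[ℚ] cmNumbers) (n : ℕ+) (u : weilGroup p n) :
    weilLimAct σ (weilGerm n u) = weilGerm n (weilAct p n σ u) := rfl

/-- `1 ∈ Γ` acts trivially on `W(p^∞)`. [cite: Milne1999, §4 p. 60 L8–L9] -/
theorem weilLimAct_one (x : WeilLimit p) : weilLimAct 1 x = x := by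
  induction x using weilGerm_induction with
  | h n u => rw [weilLimAct_weilGerm, weilAct_one]

/-- `(στ)x = σ(τx)` on `W(p^∞)`. [cite: Milne1999, §4 p. 60 L8–L9] -/
theorem weilLimAct_mul (σ τ : cmNumbers ≃ₐ[ℚ] cmNumbers) (x : WeilLimit p) :
    weilLimAct (σ * τ) x = weilLimAct σ (weilLimAct τ x) := by
  induction x using weilGerm_induction with
  | h n u => rw [weilLimAct_weilGerm, weilLimAct_weilGerm, weilLimAct_weilGerm, weilAct_mul]

/-- **«There is a natural action of `Γ` on `W(p^∞)`»** — as a `MulAction` (so that `Γ`-ORBITS `Π ⊂ W(p^∞)` make sense).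
[cite: Milne1999, §4 p. 60 L8–L9] -/
instance WeilLimit.instMulAction : MulAction (cmNumbers ≃ₐ[ℚ] cmNumbers) (WeilLimit p) where
  smul σ x := weilLimAct σ x
  one_smul x := weilLimAct_one x
  mul_smul σ τ x := weilLimAct_mul σ τ x

/-- `σ • x = weilLimAct σ x`. [cite: Milne1999, §4 p. 60 L8–L9] -/
theorem WeilLimit.smul_def (σ : cmNumbers ≃ₐ[ℚ] cmNumbers) (x : WeilLimit p) : σ • x = weilLimAct σ x := rfl

/-- `σ • [π] = [σπ]`. [cite: Milne1999, §4 p. 60 L8–L9] -/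
@[simp] theorem smul_weilGerm (σ : cmNumbers ≃ₐ[ℚ] cmNumbers) (n : ℕ+) (u : weilGroup p n) :
    σ • weilGerm n u = weilGerm n (weilAct p n σ u) := rfl

/-- The action is by group automorphisms: `σ • (xy) = (σ • x)(σ • y)`. [cite: Milne1999, §4 p. 60 L8–L9] -/
theorem smul_mul_weilLimit (σ : cmNumbers ≃ₐ[ℚ] cmNumbers) (x y : WeilLimit p) : σ • (x * y) = σ • x * σ • y :=
  map_mul (weilLimAct σ) x y

/-- **Weights are `Γ`-invariant on `W(p^∞)`.** [cite: Milne1999, §4 p. 60 L8–L9] -/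
theorem weilLimExp_smul (σ : cmNumbers ≃ₐ[ℚ] cmNumbers) (x : WeilLimit p) : weilLimExp (σ • x) = weilLimExp x := by
  induction x using weilGerm_induction with
  | h n u => rw [smul_weilGerm, weilLimExp_weilGerm, weilLimExp_weilGerm, weilExp_weilAct]

variable (p) in
/-- **`X^*(P) = W(p^∞)` AS A `Γ`-MODULE**: the representation of `Γ = Gal(ℚ^{cm}/ℚ)` on the (additively written) group `W(p^∞)` —
«the Weil-number torus `P` is defined to be the pro-torus over `ℚ` with `X^*(P) = W(p^∞)`».
[cite: Milne1999, §4 p. 60 L8–L10] -/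
def weilLimRep : Representation ℤ (cmNumbers ≃ₐ[ℚ] cmNumbers) (Additive (WeilLimit p)) where
  toFun σ := (MonoidHom.toAdditive (weilLimAct (p := p) σ)).toIntLinearMap
  map_one' := LinearMap.ext fun x => by
    change Additive.ofMul (weilLimAct 1 (Additive.toMul x)) = x
    rw [weilLimAct_one]; rfl
  map_mul' σ τ := LinearMap.ext fun x => by
    change Additive.ofMul (weilLimAct (σ * τ) (Additive.toMul x)) =
      Additive.ofMul (weilLimAct σ (Additive.toMul (Additive.ofMul (weilLimAct τ (Additive.toMul x)))))
    rw [weilLimAct_mul]; rfl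

/-- `weilLimRep σ` is the action `σ • ·` read additively. [cite: Milne1999, §4 p. 60 L8–L10] -/
@[simp] theorem weilLimRep_apply (σ : cmNumbers ≃ₐ[ℚ] cmNumbers) (x : Additive (WeilLimit p)) :
    weilLimRep p σ x = Additive.ofMul (σ • Additive.toMul x) := rfl

/-- The unit `pⁿ ∈ W(pⁿ)` (weight `−2`; `natCast_pow_mem_weilGroup`). [cite: Milne1999, §4 p. 62 L14–L16] -/
def natCastPowUnit (n : ℕ) : weilGroup p n :=
  ⟨Units.mk0 ((p : cmNumbers) ^ n) (pow_ne_zero _ (Nat.cast_ne_zero.mpr hp.out.ne_zero)), natCast_pow_mem_weilGroup p n⟩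

/-- [cite: Milne1999, §4 p. 62 L14–L16] -/
@[simp] theorem coe_natCastPowUnit (n : ℕ) :
    (((natCastPowUnit n : weilGroup p n) : cmNumbersˣ) : cmNumbers) = (p : cmNumbers) ^ n := rfl

/-- The germ `[p] ∈ W(p^∞)` of the Weil `p`-number `p` of weight `−2` (`p · p = p²`; «The element `p ∈ K` is a Weil `p`-number of
weight `−2`»). [cite: Milne1999, §4 p. 62 L14–L16] -/
def pGerm : WeilLimit p :=
  weilGerm 1 (natCastPowUnit ((1 : ℕ+) : ℕ))

/-- `[p]` unfolded. [cite: Milne1999, §4 p. 62 L14–L16] -/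
theorem pGerm_def : (pGerm : WeilLimit p) = weilGerm 1 (natCastPowUnit ((1 : ℕ+) : ℕ)) := rfl

/-- `Γ` fixes the units `pⁿ`. [cite: Milne1999, §4 p. 62 L14–L16] -/
@[simp] theorem weilAct_natCastPowUnit (σ : cmNumbers ≃ₐ[ℚ] cmNumbers) (n : ℕ) :
    weilAct p n σ (natCastPowUnit n) = natCastPowUnit n := by
  refine Subtype.ext (Units.ext ?_)
  rw [coe_weilAct, coe_natCastPowUnit, map_pow, map_natCast]

/-- **«Its class `[p]` in `W(p^∞)` is fixed under the action of `Γ`»** (so it defines `p : P → 𝔾_m` rational over `ℚ`).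
[cite: Milne1999, §4 p. 62 L14–L16] -/
theorem smul_pGerm (σ : cmNumbers ≃ₐ[ℚ] cmNumbers) : σ • (pGerm : WeilLimit p) = pGerm := by
  rw [pGerm_def, smul_weilGerm, weilAct_natCastPowUnit]

/-- `[p]` has weight `−2` (`weilExp = 2`). [cite: Milne1999, §4 p. 62 L14–L16] -/
theorem weilLimExp_pGerm : weilLimExp (pGerm : WeilLimit p) = 2 := by
  rw [pGerm_def, weilLimExp_weilGerm]
  exact weilExp_eq IsWeilNumber.natCast_pow

/-- `[p] ≠ 1` in `W(p^∞)` (its weight is `−2 ≠ 0`): the character `p` of `P` is non-trivial. [cite: Milne1999, §4 p. 62 L14–L16] -/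
theorem pGerm_ne_one : (pGerm : WeilLimit p) ≠ 1 := by
  intro h
  have h1 := weilLimExp_pGerm (p := p)
  rw [h, ← weilGerm_one 1, weilLimExp_weilGerm, weilExp_one] at h1
  exact absurd h1 (by decide)

/-! ### §4 `W_{1,+}(p^∞) = lim→ W_{1,+}(pⁿ)` -/

variable (p) in
/-- **`W_{1,+}(p^∞) = lim→ W_{1,+}(pⁿ) ⊆ W(p^∞)`**: the germs of the Weil numbers of weight `−1` that are algebraic integers.
[cite: Milne1999, §4 p. 60 L11–L12] -/
def weilLimOnePlus : Set (WeilLimit p) :=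
  {x | ∃ (n : ℕ+) (u : weilGroup p n), u ∈ weilOnePlus p n ∧ weilGerm n u = x}

/-- Membership in `W_{1,+}(p^∞)`. [cite: Milne1999, §4 p. 60 L11–L12] -/
theorem mem_weilLimOnePlus_iff (x : WeilLimit p) :
    x ∈ weilLimOnePlus p ↔ ∃ (n : ℕ+) (u : weilGroup p n), u ∈ weilOnePlus p n ∧ weilGerm n u = x := Iff.rfl

/-- `[π] ∈ W_{1,+}(p^∞)` for `π ∈ W_{1,+}(pⁿ)`. [cite: Milne1999, §4 p. 60 L11–L12] -/
theorem weilGerm_mem_weilLimOnePlus {n : ℕ+} {u : weilGroup p n} (hu : u ∈ weilOnePlus p n) :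
    weilGerm n u ∈ weilLimOnePlus p := ⟨n, u, hu, rfl⟩

/-- Elements of `W_{1,+}(p^∞)` have weight `−1`. [cite: Milne1999, §4 p. 60 L11–L12] -/
theorem weilLimExp_eq_one_of_mem {x : WeilLimit p} (hx : x ∈ weilLimOnePlus p) : weilLimExp x = 1 := by
  obtain ⟨n, u, hu, rfl⟩ := hx
  rw [weilLimExp_weilGerm]
  exact weilExp_eq_one_of_mem_weilOnePlus hu

/-- **`W_{1,+}(p^∞)` is `Γ`-stable** (so it is a union of `Γ`-orbits `Π`). [cite: Milne1999, §4 p. 60 L8–L12] -/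
theorem smul_mem_weilLimOnePlus (σ : cmNumbers ≃ₐ[ℚ] cmNumbers) {x : WeilLimit p} (hx : x ∈ weilLimOnePlus p) :
    σ • x ∈ weilLimOnePlus p := by
  obtain ⟨n, u, hu, rfl⟩ := hx
  exact ⟨n, weilAct p n σ u, weilAct_mem_weilOnePlus σ hu, rfl⟩

/-- The `Γ`-orbit of an element of `W_{1,+}(p^∞)` lies in `W_{1,+}(p^∞)` («a `Γ`-orbit `Π` in `W_{1,+}(p^∞)`»). [cite: Milne1999, §4 p. 60 L22] -/
theorem orbit_subset_weilLimOnePlus {x : WeilLimit p} (hx : x ∈ weilLimOnePlus p) :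
    MulAction.orbit (cmNumbers ≃ₐ[ℚ] cmNumbers) x ⊆ weilLimOnePlus p := by
  rintro _ ⟨σ, rfl⟩
  exact smul_mem_weilLimOnePlus σ hx

/-- `[1 + 2i] ∈ W_{1,+}(5^∞)` and `[p] ∈ W_{1,+}((p²)^∞)`… concretely: **`W_{1,+}(p^∞)` is non-empty for every prime `p`** — it
contains the germ of the supersingular Weil number `p ∈ W_{1,+}(p²)`. [cite: Milne1999, §4 p. 60 L11–L12] -/
theorem weilLimOnePlus_nonempty : (weilLimOnePlus p).Nonempty :=
  ⟨_, weilGerm_mem_weilLimOnePlus (n := 2) (natCast_mem_weilOnePlus_two p)⟩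

end Limit

/-! ### §5 The Weil-number pro-torus `P` through its points: `P(R) = Hom_Γ(W(p^∞), (ℚ^{cm} ⊗ R)ˣ)` -/

section Torus

variable (p : ℕ) [hp : Fact p.Prime]
variable (R : Type*) [CommRing R] [Algebra ℚ R]

/-- **THE WEIL-NUMBER PRO-TORUS `P` THROUGH ITS `R`-POINTS: `P(R) = D(W(p^∞))(R) = Hom_Γ(X^*(P), (ℚ^{cm} ⊗_ℚ R)ˣ)`** for every
commutative `ℚ`-algebra `R` — «the pro-torus over `ℚ` with `X^*(P) = W(p^∞)`», realised, as the Serre group `S` in g13-#3, by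
Q768 FILE 1's point functor of the group with a given `Γ`-character module over the common splitting field `ℚ^{cm}`.
[cite: Milne1999, §4 p. 60 L8–L10] -/
abbrev weilTorusPoints : Subgroup (Multiplicative (Additive (WeilLimit p)) →* (cmNumbers ⊗[ℚ] R)ˣ) :=
  torusPoints ℚ cmNumbers R (weilLimRep p)

variable {p R} in
/-- **Each germ `[π] ∈ W(p^∞) = X^*(P)` is a character of `P`**: on points, `f ↦ f([π]) ∈ (ℚ^{cm} ⊗ R)ˣ` (FILE 1's `torusPoints.eval`).
[cite: Milne1999, §4 p. 60 L8–L10] -/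
def germChar (x : WeilLimit p) : weilTorusPoints p R →* (cmNumbers ⊗[ℚ] R)ˣ :=
  torusPoints.eval ℚ cmNumbers R (weilLimRep p) (Additive.ofMul x)

variable {p R} in
/-- [cite: Milne1999, §4 p. 60 L8–L10] -/
theorem germChar_apply (x : WeilLimit p) (f : weilTorusPoints p R) :
    germChar x f = (f : Multiplicative (Additive (WeilLimit p)) →* (cmNumbers ⊗[ℚ] R)ˣ) (Multiplicative.ofAdd (Additive.ofMul x)) :=
  rfl

variable {p R} in
/-- Characters multiply: `f([π][π′]) = f([π]) f([π′])`. [cite: Milne1999, §4 p. 60 L8–L10] -/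
theorem germChar_mul (x y : WeilLimit p) (f : weilTorusPoints p R) : germChar (x * y) f = germChar x f * germChar y f := by
  rw [germChar_apply, germChar_apply, germChar_apply, ofMul_mul, ofAdd_add, map_mul]

/-- **The character `p : P → 𝔾_m` is RATIONAL OVER `ℚ`**: the values `f([p])` are `Γ`-invariant units (because `[p]` is `Γ`-fixed,
`smul_pGerm`). [cite: Milne1999, §4 p. 62 L14–L16] -/
theorem galUnits_germChar_pGerm (σ : cmNumbers ≃ₐ[ℚ] cmNumbers) (f : weilTorusPoints p R) :
    galUnits ℚ cmNumbers R σ (germChar (pGerm : WeilLimit p) f) = germChar pGerm f :=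
  torusPoints.galUnits_eval_of_forall_eq ℚ cmNumbers R (weilLimRep p)
    (fun τ => by rw [weilLimRep_apply]; exact congrArg Additive.ofMul (smul_pGerm τ)) σ f

end Torus

/-! ### §6 The tori `(L^Π, l^Π)` of the `Γ`-orbits `Π ⊂ W(p^∞)` -/

section OrbitTori

variable {p : ℕ} [hp : Fact p.Prime]

/-- **`X^*(L^Π)`, the character module of the torus `L^Π` of the `Γ`-orbit `Π = Γ·ϖ` of a germ `ϖ ∈ W(p^∞)`**:
`{f : Π → ℤ}/{f | f = ιf and Σ_{π∈Π} f(π) = 0}` — Q731's `OrbitTorus.CharModule` for the `Γ`-set `Π` and `ι = cmNumbersConj`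
(coefficients `R`, the printed lattice being `R = ℤ`). [cite: Milne1999, §4 p. 60 L22–L25] -/
abbrev weilOrbitChar (R : Type*) [CommRing R] (ϖ : WeilLimit p) : Type _ :=
  OrbitTorus.CharModule R (MulAction.orbit (cmNumbers ≃ₐ[ℚ] cmNumbers) ϖ) cmNumbersConj

/-- **`X^*(L^Π)` as a `Γ`-module** (`ι` is central in `Γ`). [cite: Milne1999, §4 p. 60 L22–L27] -/
def weilOrbitRep (R : Type*) [CommRing R] (ϖ : WeilLimit p) :
    Representation R (cmNumbers ≃ₐ[ℚ] cmNumbers) (weilOrbitChar R ϖ) :=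
  OrbitTorus.rep R _ cmNumbersConj cmNumbersConj_mul_comm

/-- **`l^Π ∈ X^*(L^Π)`: the class of `π + ιπ`** (at the base point `ϖ` of the orbit). [cite: Milne1999, §4 p. 60 L25–L27] -/
def lWeil (R : Type*) [CommRing R] (ϖ : WeilLimit p) : weilOrbitChar R ϖ :=
  OrbitTorus.tChar R cmNumbersConj (⟨ϖ, MulAction.mem_orbit_self ϖ⟩ : MulAction.orbit (cmNumbers ≃ₐ[ℚ] cmNumbers) ϖ)

/-- **«The element `π + ιπ` of `X^*(L^Π)` is independent of the choice of `π ∈ Π`.»** [cite: Milne1999, §4 p. 60 L25–L26] -/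
theorem lWeil_eq_tChar (R : Type*) [CommRing R] (ϖ : WeilLimit p) (π : MulAction.orbit (cmNumbers ≃ₐ[ℚ] cmNumbers) ϖ) :
    lWeil R ϖ = OrbitTorus.tChar R cmNumbersConj π :=
  OrbitTorus.tChar_eq R cmNumbersConj cmNumbersConj_mul_self _ π

/-- **«… and is fixed by `Γ`.»** [cite: Milne1999, §4 p. 60 L26] -/
theorem weilOrbitRep_lWeil (R : Type*) [CommRing R] (ϖ : WeilLimit p) (σ : cmNumbers ≃ₐ[ℚ] cmNumbers) :
    weilOrbitRep R ϖ σ (lWeil R ϖ) = lWeil R ϖ :=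
  OrbitTorus.rep_tChar R cmNumbersConj cmNumbersConj_mul_comm cmNumbersConj_mul_self σ _

/-- `l^Π ≠ 0` (over `ℤ`, or any coefficient ring with `2 ≠ 0`). [cite: Milne1999, §4 p. 60 L25–L27] -/
theorem lWeil_ne_zero (R : Type*) [CommRing R] (h2 : (2 : R) ≠ 0) (ϖ : WeilLimit p) : lWeil R ϖ ≠ 0 :=
  OrbitTorus.tChar_ne_zero R cmNumbersConj h2 _

/-- Every `Γ`-orbit `Π ⊂ W(p^∞)` is `ι`-stable (`ι ∈ Γ`), so `f ↦ ιf` acts on `ℤ^Π` («`f = ιf`»; `ιπ = π` is possible, e.g.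
`Π = {[p]}` for the real Weil number `p ∈ W_{1,+}(p²)`). [cite: Milne1999, §4 p. 60 L22–L27] -/
theorem cmNumbersConj_smul_mem_orbit (ϖ : WeilLimit p) {π : WeilLimit p}
    (hπ : π ∈ MulAction.orbit (cmNumbers ≃ₐ[ℚ] cmNumbers) ϖ) :
    cmNumbersConj • π ∈ MulAction.orbit (cmNumbers ≃ₐ[ℚ] cmNumbers) ϖ := by
  obtain ⟨τ, rfl⟩ := hπ
  exact ⟨cmNumbersConj * τ, mul_smul _ _ _⟩

variable (R : Type*) [CommRing R] [Algebra ℚ R]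

/-- **THE TORUS `L^Π` THROUGH ITS `R`-POINTS: `L^Π(R) = D(X^*(L^Π))(R) = Hom_Γ(X^*(L^Π), (ℚ^{cm} ⊗_ℚ R)ˣ)`** («define `L^Π` to be the
torus over `ℚ` with character group `X^*(L^Π)`»; as Q768's `orbitTorusPoints` for `T^Ψ`). [cite: Milne1999, §4 p. 60 L22–L25] -/
abbrev weilOrbitTorusPoints (ϖ : WeilLimit p) :
    Subgroup (Multiplicative (weilOrbitChar ℤ ϖ) →* (cmNumbers ⊗[ℚ] R)ˣ) :=
  torusPoints ℚ cmNumbers R (weilOrbitRep ℤ ϖ)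

/-- **`l^Π` on points: `L^Π(R) → (ℚ^{cm} ⊗ R)ˣ`, `f ↦ f(l^Π)`.** [cite: Milne1999, §4 p. 60 L25–L27] -/
def lWeilPoints (ϖ : WeilLimit p) : weilOrbitTorusPoints R ϖ →* (cmNumbers ⊗[ℚ] R)ˣ :=
  torusPoints.eval ℚ cmNumbers R (weilOrbitRep ℤ ϖ) (lWeil ℤ ϖ)

/-- [cite: Milne1999, §4 p. 60 L25–L27] -/
theorem lWeilPoints_apply (ϖ : WeilLimit p) (f : weilOrbitTorusPoints R ϖ) :
    lWeilPoints R ϖ f = (f : Multiplicative (weilOrbitChar ℤ ϖ) →* (cmNumbers ⊗[ℚ] R)ˣ) (Multiplicative.ofAdd (lWeil ℤ ϖ)) := rfl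

/-- **«It therefore defines a homomorphism `l^Π : L^Π → 𝔾_m` rational over `ℚ`»**: the values `f(l^Π)` are `Γ`-invariant units.
[cite: Milne1999, §4 p. 60 L26–L27] -/
theorem galUnits_lWeilPoints (ϖ : WeilLimit p) (σ : cmNumbers ≃ₐ[ℚ] cmNumbers) (f : weilOrbitTorusPoints R ϖ) :
    galUnits ℚ cmNumbers R σ (lWeilPoints R ϖ f) = lWeilPoints R ϖ f :=
  torusPoints.galUnits_eval_of_forall_eq ℚ cmNumbers R (weilOrbitRep ℤ ϖ) (fun τ => weilOrbitRep_lWeil ℤ ϖ τ) σ f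

end OrbitTori

/-! ### §7 «THE MAP `β`»: `β^Π : (P, p) → (L^Π, l^Π)` for a `Γ`-orbit `Π` of weight `−1` (p. 62) -/

section Beta

variable {p : ℕ} [hp : Fact p.Prime]

/-- **`W(p^∞)` is torsion-free**, as Mathlib's `IsMulTorsionFree` (`x ↦ x^k` injective for `k ≠ 0`; from
`WeilLimit.eq_one_of_pow_eq_one`) — so that `X^*(P) = Additive W(p^∞)` is a torsion-free `ℤ`-module. [cite: Milne1999, §4 p. 60 L8–L10] -/
instance WeilLimit.instIsMulTorsionFree : IsMulTorsionFree (WeilLimit p) where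
  pow_left_injective k hk a b hab := by
    dsimp only at hab
    have h : (a / b) ^ k = 1 := by rw [div_pow, hab, div_self']
    exact div_eq_one.mp (WeilLimit.eq_one_of_pow_eq_one hk h)

/-- `[pⁿ]_n = [p]_1`: the unit `pⁿ ∈ W(pⁿ)` is the image of `p ∈ W(p)` under the transition map, so it represents `[p]`.
[cite: Milne1999, §4 p. 62 L14–L16] -/
theorem weilGerm_natCastPowUnit (n : ℕ+) : weilGerm n (natCastPowUnit (n : ℕ)) = (pGerm : WeilLimit p) := by
  have h1 : ((1 : ℕ+) : ℕ) ∣ (n : ℕ) := one_dvd _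
  rw [pGerm_def, ← weilGerm_weilTransition h1]
  congr 1
  refine Subtype.ext ?_
  rw [coe_weilTransition]
  refine Units.ext ?_
  simp only [Units.val_pow_eq_pow_val, coe_natCastPowUnit, PNat.one_coe, Nat.div_one, pow_one]

/-- **`[π]·[ιπ] = [p]` for `π ∈ W(pⁿ)` of weight `−1`** (`π·ιπ = pⁿ` and `[pⁿ]_n = [p]`). [cite: Milne1999, §4 p. 60 L25–L27, p. 62 L14–L19] -/
theorem weilGerm_mul_weilGerm_conj {n : ℕ+} (u : weilGroup p n) (hu : weilExp u = 1) :
    weilGerm n u * weilGerm n (weilAct p n cmNumbersConj u) = pGerm := by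
  rw [weilGerm_mul, ← weilGerm_natCastPowUnit n]
  congr 1
  refine Subtype.ext (Units.ext ?_)
  rw [Subgroup.coe_mul, Units.val_mul, coe_weilAct, val_mul_conj_eq_zpow_weilExp, hu, zpow_one, coe_natCastPowUnit]

/-- **`x · ιx = [p]` in `W(p^∞)` for every `x` of weight `−1`.** [cite: Milne1999, §4 p. 60 L25–L27, p. 62 L14–L19] -/
theorem mul_conj_smul_eq_pGerm {x : WeilLimit p} (hx : weilLimExp x = 1) : x * cmNumbersConj • x = pGerm := by
  obtain ⟨n, u, rfl⟩ := exists_weilGerm_eq x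
  rw [weilLimExp_weilGerm] at hx
  rw [smul_weilGerm]
  exact weilGerm_mul_weilGerm_conj u hx

/-- The weight is constant on `Γ`-orbits. [cite: Milne1999, §4 p. 60 L8–L9] -/
theorem weilLimExp_coe_orbit {ϖ : WeilLimit p} (π : MulAction.orbit (cmNumbers ≃ₐ[ℚ] cmNumbers) ϖ) :
    weilLimExp (π : WeilLimit p) = weilLimExp ϖ := by
  obtain ⟨σ, h⟩ := π.2
  rw [← h]
  exact weilLimExp_smul σ ϖ

/-- In a `Γ`-orbit `Π` of weight `−1`: `[π] + [ιπ] = [p]` in `X^*(P)` (additive notation), INDEPENDENTLY of `π ∈ Π` — the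
hypothesis of §0's `OrbitTorus.liftChar` (g15-#1). [cite: Milne1999, §4 p. 62 L17–L19] -/
theorem ofMul_coe_add_ofMul_coe_conj_smul {ϖ : WeilLimit p} (hϖ : weilLimExp ϖ = 1)
    (π : MulAction.orbit (cmNumbers ≃ₐ[ℚ] cmNumbers) ϖ) :
    Additive.ofMul (π : WeilLimit p) +
        Additive.ofMul ((cmNumbersConj • π : MulAction.orbit (cmNumbers ≃ₐ[ℚ] cmNumbers) ϖ) : WeilLimit p) =
      Additive.ofMul (pGerm : WeilLimit p) := by
  rw [MulAction.orbit.coe_smul, ← ofMul_mul, mul_conj_smul_eq_pGerm ((weilLimExp_coe_orbit π).trans hϖ)]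

/-- `2 ∈ ℤ` is regular (plumbing for §0's hypothesis). [cite: Milne1999, §4 p. 62 L17–L19] -/
private theorem isRegular_two_int' : IsRegular (2 : ℤ) := IsRegular.of_ne_zero two_ne_zero

/-- **`X^*(β^Π) : X^*(L^Π) → X^*(P) = W(p^∞)`, `[f] ↦ ∏_{π ∈ Π} π^{f(π)}`** — «The map `f ↦ ∏_{π∈Π} π^{f(π)} : ℤ^Π → W(p^∞)` factors
through `X^*(L^Π)`»: for `f = ιf` with `Σ f = 0` the product `x` satisfies `x² = ∏ (π·ιπ)^{f(π)} = [p]^{Σ f} = 1`, hence `x = 1`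
(`W(p^∞)` is torsion-free) — g15-#1's generic `OrbitTorus.liftChar` with `v(π) = [π]`, `c = [p]`, for an orbit `Π = Γ·ϖ` of
weight `−1`. [cite: Milne1999, §4 p. 62 L17–L19] -/
def betaChar (ϖ : WeilLimit p) (hϖ : weilLimExp ϖ = 1) : weilOrbitChar ℤ ϖ →ₗ[ℤ] Additive (WeilLimit p) :=
  OrbitTorus.liftChar ℤ cmNumbersConj isRegular_two_int'
    (fun π : MulAction.orbit (cmNumbers ≃ₐ[ℚ] cmNumbers) ϖ => Additive.ofMul (π : WeilLimit p)) (Additive.ofMul pGerm)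
    (ofMul_coe_add_ofMul_coe_conj_smul hϖ)

/-- **`X^*(β^Π)[δ_π] = [π]`.** [cite: Milne1999, §4 p. 62 L17–L19] -/
@[simp] theorem betaChar_mk_single (ϖ : WeilLimit p) (hϖ : weilLimExp ϖ = 1)
    (π : MulAction.orbit (cmNumbers ≃ₐ[ℚ] cmNumbers) ϖ) :
    betaChar ϖ hϖ (Submodule.Quotient.mk (Finsupp.single π 1)) = Additive.ofMul (π : WeilLimit p) :=
  OrbitTorus.liftChar_mk_single ℤ cmNumbersConj isRegular_two_int' _ _ _ π

/-- `X^*(β^Π)[f] = Σ_π f(π)·[π]` (additive notation). [cite: Milne1999, §4 p. 62 L17–L19] -/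
theorem betaChar_mk (ϖ : WeilLimit p) (hϖ : weilLimExp ϖ = 1) (f : MulAction.orbit (cmNumbers ≃ₐ[ℚ] cmNumbers) ϖ →₀ ℤ) :
    betaChar ϖ hϖ (Submodule.Quotient.mk f) =
      Finsupp.linearCombination ℤ (fun π : MulAction.orbit (cmNumbers ≃ₐ[ℚ] cmNumbers) ϖ => Additive.ofMul (π : WeilLimit p)) f :=
  rfl

/-- **THE PRINTED FORMULA `[f] ↦ ∏_{π∈Π} π^{f(π)}`** (multiplicative notation). [cite: Milne1999, §4 p. 62 L17–L18] -/
theorem toMul_betaChar_mk (ϖ : WeilLimit p) (hϖ : weilLimExp ϖ = 1) (f : MulAction.orbit (cmNumbers ≃ₐ[ℚ] cmNumbers) ϖ →₀ ℤ) :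
    Additive.toMul (betaChar ϖ hϖ (Submodule.Quotient.mk f)) = f.prod fun π k => (π : WeilLimit p) ^ k := by
  rw [betaChar_mk, Finsupp.linearCombination_apply, Finsupp.sum, Finsupp.prod, toMul_sum]
  refine Finset.prod_congr rfl fun π _ => ?_
  rw [toMul_zsmul, toMul_ofMul]

/-- **`X^*(β^Π)` is `Γ`-EQUIVARIANT** (`β^Π` is a homomorphism of tori over `ℚ`): `[σπ] = σ[π]`. [cite: Milne1999, §4 p. 62 L17–L19] -/
theorem betaChar_weilOrbitRep (ϖ : WeilLimit p) (hϖ : weilLimExp ϖ = 1) (σ : cmNumbers ≃ₐ[ℚ] cmNumbers) (x : weilOrbitChar ℤ ϖ) :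
    betaChar ϖ hϖ (weilOrbitRep ℤ ϖ σ x) = weilLimRep p σ (betaChar ϖ hϖ x) :=
  OrbitTorus.liftChar_rep ℤ cmNumbersConj isRegular_two_int' _ _ _ cmNumbersConj_mul_comm
    (fun τ => (weilLimRep p τ : Additive (WeilLimit p) →ₗ[ℤ] Additive (WeilLimit p)))
    (fun τ π => by rw [MulAction.orbit.coe_smul, weilLimRep_apply, toMul_ofMul]) σ x

/-- **«This map sends `p` to `l^Π`»** on characters: `X^*(β^Π)(l^Π) = [π] + [ιπ] = [p]`. [cite: Milne1999, §4 p. 62 L19] -/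
theorem betaChar_lWeil (ϖ : WeilLimit p) (hϖ : weilLimExp ϖ = 1) : betaChar ϖ hϖ (lWeil ℤ ϖ) = Additive.ofMul pGerm :=
  OrbitTorus.liftChar_tChar ℤ cmNumbersConj isRegular_two_int' _ _ _ _

variable (R : Type*) [CommRing R] [Algebra ℚ R]

/-- **`β^Π(R) : P(R) → L^Π(R)` ON POINTS** («hence, defines a homomorphism `β^Π : P → L^Π`»), for every commutative `ℚ`-algebra `R`:
Q768 FILE 1's `torusPoints.comap` of the equivariant `X^*(β^Π)`. [cite: Milne1999, §4 p. 62 L17–L19] -/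
def betaPoints (ϖ : WeilLimit p) (hϖ : weilLimExp ϖ = 1) : weilTorusPoints p R →* weilOrbitTorusPoints R ϖ :=
  torusPoints.comap ℚ cmNumbers R (weilOrbitRep ℤ ϖ) (weilLimRep p) (betaChar ϖ hϖ) (betaChar_weilOrbitRep ϖ hϖ)

variable {R} in
/-- Values: `β^Π(f)(x) = f(X^*(β^Π) x)`. [cite: Milne1999, §4 p. 62 L17–L19] -/
theorem betaPoints_apply_ofAdd (ϖ : WeilLimit p) (hϖ : weilLimExp ϖ = 1) (f : weilTorusPoints p R) (x : weilOrbitChar ℤ ϖ) :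
    (betaPoints R ϖ hϖ f : Multiplicative (weilOrbitChar ℤ ϖ) →* (cmNumbers ⊗[ℚ] R)ˣ) (Multiplicative.ofAdd x) =
      (f : Multiplicative (Additive (WeilLimit p)) →* (cmNumbers ⊗[ℚ] R)ˣ) (Multiplicative.ofAdd (betaChar ϖ hϖ x)) := rfl

variable {R} in
/-- **`β^Π(f)([δ_π]) = f([π])`**: on the generator `[δ_π]` of `X^*(L^Π)` the point `β^Π(f)` is the value of `f` at the character
`[π]` of `P`. [cite: Milne1999, §4 p. 62 L17–L19] -/
theorem betaPoints_apply_mk_single (ϖ : WeilLimit p) (hϖ : weilLimExp ϖ = 1) (f : weilTorusPoints p R)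
    (π : MulAction.orbit (cmNumbers ≃ₐ[ℚ] cmNumbers) ϖ) :
    (betaPoints R ϖ hϖ f : Multiplicative (weilOrbitChar ℤ ϖ) →* (cmNumbers ⊗[ℚ] R)ˣ)
        (Multiplicative.ofAdd (Submodule.Quotient.mk (Finsupp.single π 1))) = germChar (π : WeilLimit p) f := by
  rw [betaPoints_apply_ofAdd, betaChar_mk_single, germChar_apply]

variable {R} {R' : Type*} [CommRing R'] [Algebra ℚ R'] in
/-- `β^Π` is natural in `R`. [cite: Milne1999, §4 p. 62 L17–L19] -/
theorem map_betaPoints (ϖ : WeilLimit p) (hϖ : weilLimExp ϖ = 1) (φ : R →ₐ[ℚ] R') (f : weilTorusPoints p R) :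
    torusPoints.map ℚ cmNumbers R (weilOrbitRep ℤ ϖ) R' φ (betaPoints R ϖ hϖ f) =
      betaPoints R' ϖ hϖ (torusPoints.map ℚ cmNumbers R (weilLimRep p) R' φ f) := rfl

variable {R} in
/-- **«This map sends `p` to `l^Π`»** on points: `l^Π(β^Π(f)) = p(f)`, i.e. `β^Π : (P, p) → (L^Π, l^Π)` is a morphism of PAIRS.
[cite: Milne1999, §4 p. 62 L19–L20] -/
theorem lWeilPoints_betaPoints (ϖ : WeilLimit p) (hϖ : weilLimExp ϖ = 1) (f : weilTorusPoints p R) :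
    lWeilPoints R ϖ (betaPoints R ϖ hϖ f) = germChar pGerm f :=
  -- term mode (as g15-#1's `tOrbitTorus_gammaPoints`): both sides are values of `f`
  (lWeilPoints_apply R ϖ (betaPoints R ϖ hϖ f)).trans
    ((betaPoints_apply_ofAdd ϖ hϖ f (lWeil ℤ ϖ)).trans
      (congrArg (fun x : Additive (WeilLimit p) =>
        (f : Multiplicative (Additive (WeilLimit p)) →* (cmNumbers ⊗[ℚ] R)ˣ) (Multiplicative.ofAdd x)) (betaChar_lWeil ϖ hϖ)))

/-- **`l^Π ∘ β^Π = p`** as homomorphisms on `R`-points. [cite: Milne1999, §4 p. 62 L19–L20] -/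
theorem lWeilPoints_comp_betaPoints (ϖ : WeilLimit p) (hϖ : weilLimExp ϖ = 1) :
    (lWeilPoints R ϖ).comp (betaPoints R ϖ hϖ) = germChar pGerm :=
  MonoidHom.ext fun f => lWeilPoints_betaPoints ϖ hϖ f

/-- `β^Π` is defined on every orbit `Π ⊂ W_{1,+}(p^∞)` (these have weight `−1`). [cite: Milne1999, §4 p. 62 L17] -/
theorem weilLimExp_eq_one_of_mem_weilLimOnePlus {ϖ : WeilLimit p} (hϖ : ϖ ∈ weilLimOnePlus p) : weilLimExp ϖ = 1 :=
  weilLimExp_eq_one_of_mem hϖ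

end Beta

end CMNumbers

end Literature.NumberTheory.ComplexMultiplication

end
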